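import Mathlib

/-!
# Solo-blind seat (MatrixMultiplication), s77 — a MIXED tight configuration for the two-sided Kraft inequality (K±)
(paper/KraftK3.md §7.20, CLAIMS c817–c825)

Background (door I1⁗, the Kraft inequality (K₃) for zero-sum-free sequences over `𝔽₃`): for a zero-sum-free
`h : [n] → 𝔽₃^r` and a target `τ`, write `F(τ)` for the set of subsets `T` with `∑_{i ∈ T} h i = τ` and
`K(τ) = ∑_{T ∈ F(τ)} 2^{-|T|}`; (K₃) is the conjecture `K(τ) ≤ 1`.  Session s77 found (and verified exhaustively in rank `≤ 5`,
`6·10^10` cells) the TWO-SIDED sharpening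

  (K±)  `∑_{T ∈ Min(F(τ) ∪ F(-τ))} 2^{-|T|} ≤ 1`,   `Min` = the inclusion-minimal members of the union of the two fibres,

which implies (K₃) (pen, KraftK3 K3.20.6) and, unlike (K₃), is tight in MIXED configurations.  This file certifies the smallest
mixed tight instance in the kernel: for the zero-sum-free `soloBlindTK_h : Fin 8 → 𝔽₃⁴` below (rank 4, maximal length `8 = 2·4`)
and `τ = (1,0,1,1)`:
* `F(τ)` = the 4 triples `{0,1,6}, {0,2,3}, {1,4,5}, {2,4,7}` and the 2 six-sets `{0,3,4,5,6,7}, {1,2,3,5,6,7}`;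
  `F(-τ)` = the 4 triples `{0,5,7}, {1,3,7}, {2,5,6}, {3,4,6}` and the 2 six-sets `{0,1,2,3,4,5}, {0,1,2,4,6,7}`
  (each six-set is the disjoint union of two triples of the OTHER sign);
* hence `2^8·K(τ) = 2^8·K(-τ) = 4·32 + 2·4 = 136`, so `K(τ) + K(-τ) = 17/16 > 1`: the naive two-sided Kraft sum exceeds 1;
* the inclusion-minimal members of `F(τ) ∪ F(-τ)` are exactly the 8 triples (a 3-regular `8₃` configuration of Möbius–Kantor
  type on the 8 terms), and their Kraft sum is `8·2^{-3} = 1` EXACTLY: (K±) is tight with both signs present;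
* per layer, `N₃(τ) = N₃(-τ) = 4`, so the symmetric layer bound `L±(3): N₃(τ) + N₃(-τ) ≤ 2³` (KraftK3 K3.20.3) is tight with
  both sides nonzero.
Pure finite combinatorics over `2^8` subsets (`decide +kernel`); no `ω` content.
-/

set_option linter.dupNamespace false
set_option autoImplicit false

namespace Summit.MatrixMultiplication.MatrixMultiplication.Theorems

open Finset BigOperators

/-- The group `𝔽₃⁴`, as a nested product (computation-friendly for `decide`). -/
abbrev SoloBlindG4 : Type := ZMod 3 × ZMod 3 × ZMod 3 × ZMod 3

/-- The explicit zero-sum-free sequence of length 8 in `𝔽₃⁴`: `e₁, e₂, e₃, e₄, (2,1,1,0), (2,1,0,1), (0,2,1,1), (2,2,2,1)`. -/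
def soloBlindTK_h : Fin 8 → SoloBlindG4 :=
  ![(1, 0, 0, 0), (0, 1, 0, 0), (0, 0, 1, 0), (0, 0, 0, 1), (2, 1, 1, 0), (2, 1, 0, 1), (0, 2, 1, 1), (2, 2, 2, 1)]

/-- The target `τ = (1,0,1,1)`; its negative is `-τ = (2,0,2,2)`. -/
def soloBlindTK_tau : SoloBlindG4 := (1, 0, 1, 1)

/-- The fibre of `τ`: 4 triples and 2 six-sets. -/
def soloBlindTK_fibrePos : Finset (Finset (Fin 8)) :=
  {{0, 1, 6}, {0, 2, 3}, {1, 4, 5}, {2, 4, 7}, {0, 3, 4, 5, 6, 7}, {1, 2, 3, 5, 6, 7}}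

/-- The fibre of `-τ`: 4 triples and 2 six-sets. -/
def soloBlindTK_fibreNeg : Finset (Finset (Fin 8)) :=
  {{0, 5, 7}, {1, 3, 7}, {2, 5, 6}, {3, 4, 6}, {0, 1, 2, 3, 4, 5}, {0, 1, 2, 4, 6, 7}}

/-- The 8 triples: the inclusion-minimal members of `F(τ) ∪ F(-τ)`. -/
def soloBlindTK_minimal : Finset (Finset (Fin 8)) :=
  {{0, 1, 6}, {0, 2, 3}, {1, 4, 5}, {2, 4, 7}, {0, 5, 7}, {1, 3, 7}, {2, 5, 6}, {3, 4, 6}}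

set_option maxHeartbeats 0 in
/-- ZERO-SUM FREE: the only subset of `soloBlindTK_h` summing to zero is the empty one (all `2^8` subsets, in the kernel). -/
theorem soloBlindTK_zsf : ∀ T : Finset (Fin 8), ∑ i ∈ T, soloBlindTK_h i = 0 → T = ∅ := by
  decide +kernel

set_option maxHeartbeats 0 in
/-- THE FIBRE OF `τ` is exactly `soloBlindTK_fibrePos`. -/
theorem soloBlindTK_fibrePos_spec : ∀ T : Finset (Fin 8),
    (∑ i ∈ T, soloBlindTK_h i = soloBlindTK_tau) ↔ T ∈ soloBlindTK_fibrePos := by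
  decide +kernel

set_option maxHeartbeats 0 in
/-- THE FIBRE OF `-τ` is exactly `soloBlindTK_fibreNeg`. -/
theorem soloBlindTK_fibreNeg_spec : ∀ T : Finset (Fin 8),
    (∑ i ∈ T, soloBlindTK_h i = -soloBlindTK_tau) ↔ T ∈ soloBlindTK_fibreNeg := by
  decide +kernel

set_option maxHeartbeats 0 in
/-- MINIMAL MEMBERS: a member of `F(τ) ∪ F(-τ)` contains no other member strictly iff it is one of the 8 triples,
and the 8 triples are members. -/
theorem soloBlindTK_minimal_spec : ∀ T ∈ soloBlindTK_fibrePos ∪ soloBlindTK_fibreNeg,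
    ((∀ S ∈ soloBlindTK_fibrePos ∪ soloBlindTK_fibreNeg, S ⊆ T → S = T) ↔ T ∈ soloBlindTK_minimal) := by
  decide +kernel

set_option maxHeartbeats 0 in
/-- The minimal family lies in the union of the two fibres, with 4 members of each sign, all of size 3. -/
theorem soloBlindTK_minimal_facts :
    soloBlindTK_minimal ⊆ soloBlindTK_fibrePos ∪ soloBlindTK_fibreNeg ∧
    (soloBlindTK_minimal ∩ soloBlindTK_fibrePos).card = 4 ∧ (soloBlindTK_minimal ∩ soloBlindTK_fibreNeg).card = 4 ∧
    (∀ T ∈ soloBlindTK_minimal, T.card = 3) ∧ soloBlindTK_minimal.card = 8 := by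
  decide +kernel

set_option maxHeartbeats 0 in
/-- KRAFT SUMS scaled by `2^8`: each fibre has Kraft sum `136/256 = 17/32` (so `K(τ) + K(-τ) = 17/16 > 1`), while the
minimal family has Kraft sum exactly `256/256 = 1`: the two-sided inequality (K±) is TIGHT here with both signs present. -/
theorem soloBlindTK_kraft :
    ∑ T ∈ soloBlindTK_fibrePos, 2 ^ (8 - T.card) = 136 ∧ ∑ T ∈ soloBlindTK_fibreNeg, 2 ^ (8 - T.card) = 136 ∧
    ∑ T ∈ soloBlindTK_minimal, 2 ^ (8 - T.card) = 256 ∧ 136 + 136 > 2 ^ 8 := by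
  decide +kernel

set_option maxHeartbeats 0 in
/-- LAYER 3: `N₃(τ) = N₃(-τ) = 4`, so `N₃(τ) + N₃(-τ) = 8 = 2³` — the symmetric layer bound `L±(3)` is attained with both
sides nonzero (by contrast a single fibre attains `N₃ = 8` only in the twin-cube configurations). -/
theorem soloBlindTK_layer3 :
    (soloBlindTK_fibrePos.filter (fun T => T.card = 3)).card = 4 ∧
    (soloBlindTK_fibreNeg.filter (fun T => T.card = 3)).card = 4 := by
  decide +kernel

set_option maxHeartbeats 0 in
/-- Summary in fibre language: for the zero-sum-free `soloBlindTK_h` and `τ = soloBlindTK_tau`, the subsets summing to `±τ`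
that are inclusion-minimal among all such subsets are 8 triples with `∑ 2^{8-|T|} = 2^8`, whereas all subsets summing to `τ`
(resp. `-τ`) have `∑ 2^{8-|T|} = 136` each. -/
theorem soloBlind_twoSidedKraft_mixed_tight :
    (∀ T : Finset (Fin 8), ∑ i ∈ T, soloBlindTK_h i = 0 → T = ∅) ∧
    (∀ T : Finset (Fin 8), (∑ i ∈ T, soloBlindTK_h i = soloBlindTK_tau ∨ ∑ i ∈ T, soloBlindTK_h i = -soloBlindTK_tau) →
        ((∀ S : Finset (Fin 8), (∑ i ∈ S, soloBlindTK_h i = soloBlindTK_tau ∨ ∑ i ∈ S, soloBlindTK_h i = -soloBlindTK_tau) →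
            S ⊆ T → S = T) ↔ T ∈ soloBlindTK_minimal)) ∧
    ∑ T ∈ soloBlindTK_minimal, 2 ^ (8 - T.card) = 2 ^ 8 ∧
    ∑ T ∈ soloBlindTK_fibrePos, 2 ^ (8 - T.card) + ∑ T ∈ soloBlindTK_fibreNeg, 2 ^ (8 - T.card) > 2 ^ 8 := by
  refine ⟨soloBlindTK_zsf, ?_, by decide +kernel, by decide +kernel⟩
  intro T hT
  have hT' : T ∈ soloBlindTK_fibrePos ∪ soloBlindTK_fibreNeg := by
    rcases hT with h | h
    · exact mem_union_left _ ((soloBlindTK_fibrePos_spec T).1 h)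
    · exact mem_union_right _ ((soloBlindTK_fibreNeg_spec T).1 h)
  rw [← soloBlindTK_minimal_spec T hT']
  constructor
  · intro hmin S hS hST
    have hS' : ∑ i ∈ S, soloBlindTK_h i = soloBlindTK_tau ∨ ∑ i ∈ S, soloBlindTK_h i = -soloBlindTK_tau := by
      rcases mem_union.1 hS with h | h
      · exact Or.inl ((soloBlindTK_fibrePos_spec S).2 h)
      · exact Or.inr ((soloBlindTK_fibreNeg_spec S).2 h)
    exact hmin S hS' hST
  · intro hmin S hS hST
    have hS' : S ∈ soloBlindTK_fibrePos ∪ soloBlindTK_fibreNeg := by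
      rcases hS with h | h
      · exact mem_union_left _ ((soloBlindTK_fibrePos_spec S).1 h)
      · exact mem_union_right _ ((soloBlindTK_fibreNeg_spec S).1 h)
    exact hmin S hS' hST

end Summit.MatrixMultiplication.MatrixMultiplication.Theorems
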